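import Summits.Ventures.HodgeRepro.Night3GSetTwist
import Summits.Ventures.HodgeRepro.Night3GSetWeilModelKP
import Summits.Ventures.HodgeRepro.Night3CensusS4Rows

/-!
# «S4 on the CONCRETE Weil spaces of the sealed census representatives ⟹ S4» on the `G`-set model, for the eleven
sealed Galois CM types of degree 6 / 8 / 12

Blind re-derivation cell `pub-hodge-repro`, seat `night-3` (gen 4).  Imports night-3's `Night3GSetTwist` (the twist on
the concrete model; `htwist_of_alg`: twist invariance of «algebraic» from twist compatibility of `Alg`),
`Night3GSetWeilModelKP` (the honest instance `gsetModelKP` with Lemma P as the theorems `alg_add` / `alg_cancel`) and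
gen 3's `Night3CensusS4Rows` (the predicate-form census: `Census.alg_of_reps` — the twist reduction composed with the
sealed rows as twist covers, `coversFaces Γ reps = true` decided on the kernel — and its eleven instances
`alg_of_reps_<row>`, `alg_of_sexticFace`).  Namespace `HodgeRepro.Night3.GSetModel`.

On the sealed engine's element type `Elt Γ` (a synonym of `Fin n`; the group of the Cayley table `Γ`, its complex
conjugation `Elt.conj Γ`) the concrete model needs a linear order on `G = Elt Γ` (only «some order» is used, for the
lex-ordered wedge basis): `instLinearOrderElt` takes that of `Fin n`.  Then, for every sealed row:

**`weilSpace_le_alg_of_reps_<row>`** — if the algebraic classes `Alg` satisfy `hmul` (on the cross product `μ`) /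
`hproj` / `hQ` (Lemma P's algebraic-cycle identifications on the concrete Künneth maps and lines) and are
twist-compatible (`halg`), if the concrete Weil spaces of the conjugate pairs are algebraic (`hpair`, Lefschetz (1,1))
and if the concrete Weil spaces of the corner products of the row's SEALED representatives are algebraic (`hreps`:
1 / 3, 4, 4, 6, 5, 3 / 20, 22, 26, 20 faces — one per Galois-twist class, gen 3's cover + uniqueness), then the concrete
Weil space of EVERY zero-sum corner product of that Galois CM type is algebraic — S4 for the eleven sealed types, with
Lemma L, the closure combinatorics, Lemma P's linear algebra, the Künneth / eigenline bookkeeping and the twist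
bookkeeping all in the kernel, and the Hodge theory in the named hypotheses on `Alg` and `Q` only.
`weilSpace_le_alg_of_reps` is the generic form (any Cayley table with `coversFaces Γ reps = true`);
`weilSpace_le_alg_of_sexticFace` is degree 6 with its ONE face as the hypothesis.

STATUS OF RECORD: `hreps` (S4 on the 114 sealed representatives) stays a hypothesis; `Alg` / `Q` are abstract; `K = L = ℂ`;
no open input of ROUTE.md is closed; nothing here asserts anything about the original programme; HC_CM is NOT proved by
anyone in this repository.
-/

set_option autoImplicit false

open Finset Module TensorProduct
open scoped Pointwise

namespace HodgeRepro.Night3.GSetModel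

open Summit.Ventures.HodgeRepro.FaceCensus HodgeRepro.EngineBridge HodgeRepro.Night3.GSet HodgeRepro.Night3.Census

variable {n : ℕ}

/-- A linear order on the sealed engine's element type `Elt Γ` (that of `Fin n`): the concrete model needs SOME linear
order on the group for its lex-ordered wedge basis; nothing depends on which. -/
noncomputable instance instLinearOrderElt (Γ : CMGaloisType n) : LinearOrder (Elt Γ) :=
  inferInstanceAs (LinearOrder (Fin n))

/-- **The generic form**: for a Cayley table `Γ` whose sealed representatives `reps` cover the faces up to twist
(`coversFaces Γ reps = true`), S4 on the concrete Weil spaces of the representatives' corner products + Lefschetz (1,1)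
on the pairs + Lemma P's hypotheses on `Alg` / `Q` + twist compatibility of `Alg` ⟹ the concrete Weil space of every
zero-sum corner product is algebraic (gen 3's `Census.alg_of_reps` with Lemma P from `gsetModelKP`, `htwist` by
`htwist_of_alg`). -/
theorem weilSpace_le_alg_of_reps (Γ : CMGaloisType n) [Fact (Γ.isCMGaloisType = true)] (reps : List (ℕ × ℕ × ℕ))
    (hcov : coversFaces Γ reps = true)
    (Alg : ∀ M : Multiset (Finset (Elt Γ)), Submodule ℂ (H M))
    (Q : ∀ M : Multiset (Finset (Elt Γ)), LinearMap.BilinForm ℂ (H M))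
    (hmul : ∀ M N, (Submodule.map₂ (TensorProduct.mk ℂ (H M) (H N)) (Alg M) (Alg N)).map (μ M N) ≤ Alg (M + N))
    (hproj : ∀ M N (y : H N), y ∈ Alg N →
      ((Alg (M + N)).map (κ M N)).map (LemmaP.contract ((Q N).flip y)) ≤ Alg M)
    (hQ : ∀ N, N ≠ 0 → ∀ σ, ∃ τ, Q N (line (Multiset.card N) σ) (line (Multiset.card N) τ) ≠ 0)
    (halg : ∀ M g, (Alg M).map (twistEquiv M g : H M →ₗ[ℂ] H (twistMul M g)) ≤ Alg (twistMul M g))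
    (hpair : ∀ Φ, IsCMType (Elt.conj Γ) Φ → weilSpace {Φ, Elt.conj Γ • Φ} ≤ Alg {Φ, Elt.conj Γ • Φ})
    (hreps : ∀ r ∈ reps, weilSpace (cornersMul Γ r) ≤ Alg (cornersMul Γ r))
    (M : Multiset (Finset (Elt Γ))) (hM : IsZeroSumG (Elt.conj Γ) M) : weilSpace M ≤ Alg M :=
  Census.alg_of_reps Γ reps hcov (fun N => weilSpace N ≤ Alg N)
    (fun M N _ _ => (gsetModelKP Alg Q hmul hproj hQ).alg_add M N)
    (fun M N _ _ => (gsetModelKP Alg Q hmul hproj hQ).alg_cancel M N) hpair (htwist_of_alg Alg halg) hreps M hM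

/-- **Row `Sextic.Cyclic`** (degree 6, cyclic; 1 representative) on the concrete model: S4 on the concrete Weil spaces of the sealed representatives'
corner products ⟹ S4 for every corner product of this Galois CM type. -/
theorem weilSpace_le_alg_of_reps_sexticCyclic
    (Alg : ∀ M : Multiset (Finset (Elt Sextic.Cyclic.Γ)), Submodule ℂ (H M))
    (Q : ∀ M : Multiset (Finset (Elt Sextic.Cyclic.Γ)), LinearMap.BilinForm ℂ (H M))
    (hmul : ∀ M N, (Submodule.map₂ (TensorProduct.mk ℂ (H M) (H N)) (Alg M) (Alg N)).map (μ M N) ≤ Alg (M + N))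
    (hproj : ∀ M N (y : H N), y ∈ Alg N →
      ((Alg (M + N)).map (κ M N)).map (LemmaP.contract ((Q N).flip y)) ≤ Alg M)
    (hQ : ∀ N, N ≠ 0 → ∀ σ, ∃ τ, Q N (line (Multiset.card N) σ) (line (Multiset.card N) τ) ≠ 0)
    (halg : ∀ M g, (Alg M).map (twistEquiv M g : H M →ₗ[ℂ] H (twistMul M g)) ≤ Alg (twistMul M g))
    (hpair : ∀ Φ, IsCMType (Elt.conj Sextic.Cyclic.Γ) Φ → weilSpace {Φ, Elt.conj Sextic.Cyclic.Γ • Φ} ≤ Alg {Φ, Elt.conj Sextic.Cyclic.Γ • Φ})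
    (hreps : ∀ r ∈ Sextic.Cyclic.reps, weilSpace (cornersMul Sextic.Cyclic.Γ r) ≤ Alg (cornersMul Sextic.Cyclic.Γ r))
    (M : Multiset (Finset (Elt Sextic.Cyclic.Γ))) (hM : IsZeroSumG (Elt.conj Sextic.Cyclic.Γ) M) : weilSpace M ≤ Alg M :=
  Census.alg_of_reps_sexticCyclic (fun N => weilSpace N ≤ Alg N)
    (fun M N _ _ => (gsetModelKP Alg Q hmul hproj hQ).alg_add M N)
    (fun M N _ _ => (gsetModelKP Alg Q hmul hproj hQ).alg_cancel M N) hpair (htwist_of_alg Alg halg) hreps M hM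

/-- **Row `Octic.Cyclic`** (degree 8, cyclic; 3) on the concrete model: S4 on the concrete Weil spaces of the sealed representatives'
corner products ⟹ S4 for every corner product of this Galois CM type. -/
theorem weilSpace_le_alg_of_reps_octicCyclic
    (Alg : ∀ M : Multiset (Finset (Elt Octic.Cyclic.Γ)), Submodule ℂ (H M))
    (Q : ∀ M : Multiset (Finset (Elt Octic.Cyclic.Γ)), LinearMap.BilinForm ℂ (H M))
    (hmul : ∀ M N, (Submodule.map₂ (TensorProduct.mk ℂ (H M) (H N)) (Alg M) (Alg N)).map (μ M N) ≤ Alg (M + N))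
    (hproj : ∀ M N (y : H N), y ∈ Alg N →
      ((Alg (M + N)).map (κ M N)).map (LemmaP.contract ((Q N).flip y)) ≤ Alg M)
    (hQ : ∀ N, N ≠ 0 → ∀ σ, ∃ τ, Q N (line (Multiset.card N) σ) (line (Multiset.card N) τ) ≠ 0)
    (halg : ∀ M g, (Alg M).map (twistEquiv M g : H M →ₗ[ℂ] H (twistMul M g)) ≤ Alg (twistMul M g))
    (hpair : ∀ Φ, IsCMType (Elt.conj Octic.Cyclic.Γ) Φ → weilSpace {Φ, Elt.conj Octic.Cyclic.Γ • Φ} ≤ Alg {Φ, Elt.conj Octic.Cyclic.Γ • Φ})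
    (hreps : ∀ r ∈ Octic.Cyclic.reps, weilSpace (cornersMul Octic.Cyclic.Γ r) ≤ Alg (cornersMul Octic.Cyclic.Γ r))
    (M : Multiset (Finset (Elt Octic.Cyclic.Γ))) (hM : IsZeroSumG (Elt.conj Octic.Cyclic.Γ) M) : weilSpace M ≤ Alg M :=
  Census.alg_of_reps_octicCyclic (fun N => weilSpace N ≤ Alg N)
    (fun M N _ _ => (gsetModelKP Alg Q hmul hproj hQ).alg_add M N)
    (fun M N _ _ => (gsetModelKP Alg Q hmul hproj hQ).alg_cancel M N) hpair (htwist_of_alg Alg halg) hreps M hM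

/-- **Row `Octic.C4C2Square`** (degree 8, C4 × C2 with c a square; 4) on the concrete model: S4 on the concrete Weil spaces of the sealed representatives'
corner products ⟹ S4 for every corner product of this Galois CM type. -/
theorem weilSpace_le_alg_of_reps_octicC4C2Square
    (Alg : ∀ M : Multiset (Finset (Elt Octic.C4C2Square.Γ)), Submodule ℂ (H M))
    (Q : ∀ M : Multiset (Finset (Elt Octic.C4C2Square.Γ)), LinearMap.BilinForm ℂ (H M))
    (hmul : ∀ M N, (Submodule.map₂ (TensorProduct.mk ℂ (H M) (H N)) (Alg M) (Alg N)).map (μ M N) ≤ Alg (M + N))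
    (hproj : ∀ M N (y : H N), y ∈ Alg N →
      ((Alg (M + N)).map (κ M N)).map (LemmaP.contract ((Q N).flip y)) ≤ Alg M)
    (hQ : ∀ N, N ≠ 0 → ∀ σ, ∃ τ, Q N (line (Multiset.card N) σ) (line (Multiset.card N) τ) ≠ 0)
    (halg : ∀ M g, (Alg M).map (twistEquiv M g : H M →ₗ[ℂ] H (twistMul M g)) ≤ Alg (twistMul M g))
    (hpair : ∀ Φ, IsCMType (Elt.conj Octic.C4C2Square.Γ) Φ → weilSpace {Φ, Elt.conj Octic.C4C2Square.Γ • Φ} ≤ Alg {Φ, Elt.conj Octic.C4C2Square.Γ • Φ})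
    (hreps : ∀ r ∈ Octic.C4C2Square.reps, weilSpace (cornersMul Octic.C4C2Square.Γ r) ≤ Alg (cornersMul Octic.C4C2Square.Γ r))
    (M : Multiset (Finset (Elt Octic.C4C2Square.Γ))) (hM : IsZeroSumG (Elt.conj Octic.C4C2Square.Γ) M) : weilSpace M ≤ Alg M :=
  Census.alg_of_reps_octicC4C2Square (fun N => weilSpace N ≤ Alg N)
    (fun M N _ _ => (gsetModelKP Alg Q hmul hproj hQ).alg_add M N)
    (fun M N _ _ => (gsetModelKP Alg Q hmul hproj hQ).alg_cancel M N) hpair (htwist_of_alg Alg halg) hreps M hM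

/-- **Row `Octic.C4C2Nonsquare`** (degree 8, C4 × C2 with c not a square; 4) on the concrete model: S4 on the concrete Weil spaces of the sealed representatives'
corner products ⟹ S4 for every corner product of this Galois CM type. -/
theorem weilSpace_le_alg_of_reps_octicC4C2Nonsquare
    (Alg : ∀ M : Multiset (Finset (Elt Octic.C4C2Nonsquare.Γ)), Submodule ℂ (H M))
    (Q : ∀ M : Multiset (Finset (Elt Octic.C4C2Nonsquare.Γ)), LinearMap.BilinForm ℂ (H M))
    (hmul : ∀ M N, (Submodule.map₂ (TensorProduct.mk ℂ (H M) (H N)) (Alg M) (Alg N)).map (μ M N) ≤ Alg (M + N))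
    (hproj : ∀ M N (y : H N), y ∈ Alg N →
      ((Alg (M + N)).map (κ M N)).map (LemmaP.contract ((Q N).flip y)) ≤ Alg M)
    (hQ : ∀ N, N ≠ 0 → ∀ σ, ∃ τ, Q N (line (Multiset.card N) σ) (line (Multiset.card N) τ) ≠ 0)
    (halg : ∀ M g, (Alg M).map (twistEquiv M g : H M →ₗ[ℂ] H (twistMul M g)) ≤ Alg (twistMul M g))
    (hpair : ∀ Φ, IsCMType (Elt.conj Octic.C4C2Nonsquare.Γ) Φ → weilSpace {Φ, Elt.conj Octic.C4C2Nonsquare.Γ • Φ} ≤ Alg {Φ, Elt.conj Octic.C4C2Nonsquare.Γ • Φ})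
    (hreps : ∀ r ∈ Octic.C4C2Nonsquare.reps, weilSpace (cornersMul Octic.C4C2Nonsquare.Γ r) ≤ Alg (cornersMul Octic.C4C2Nonsquare.Γ r))
    (M : Multiset (Finset (Elt Octic.C4C2Nonsquare.Γ))) (hM : IsZeroSumG (Elt.conj Octic.C4C2Nonsquare.Γ) M) : weilSpace M ≤ Alg M :=
  Census.alg_of_reps_octicC4C2Nonsquare (fun N => weilSpace N ≤ Alg N)
    (fun M N _ _ => (gsetModelKP Alg Q hmul hproj hQ).alg_add M N)
    (fun M N _ _ => (gsetModelKP Alg Q hmul hproj hQ).alg_cancel M N) hpair (htwist_of_alg Alg halg) hreps M hM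

/-- **Row `Octic.Triquadratic`** (degree 8, C2 × C2 × C2; 6) on the concrete model: S4 on the concrete Weil spaces of the sealed representatives'
corner products ⟹ S4 for every corner product of this Galois CM type. -/
theorem weilSpace_le_alg_of_reps_octicTriquadratic
    (Alg : ∀ M : Multiset (Finset (Elt Octic.Triquadratic.Γ)), Submodule ℂ (H M))
    (Q : ∀ M : Multiset (Finset (Elt Octic.Triquadratic.Γ)), LinearMap.BilinForm ℂ (H M))
    (hmul : ∀ M N, (Submodule.map₂ (TensorProduct.mk ℂ (H M) (H N)) (Alg M) (Alg N)).map (μ M N) ≤ Alg (M + N))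
    (hproj : ∀ M N (y : H N), y ∈ Alg N →
      ((Alg (M + N)).map (κ M N)).map (LemmaP.contract ((Q N).flip y)) ≤ Alg M)
    (hQ : ∀ N, N ≠ 0 → ∀ σ, ∃ τ, Q N (line (Multiset.card N) σ) (line (Multiset.card N) τ) ≠ 0)
    (halg : ∀ M g, (Alg M).map (twistEquiv M g : H M →ₗ[ℂ] H (twistMul M g)) ≤ Alg (twistMul M g))
    (hpair : ∀ Φ, IsCMType (Elt.conj Octic.Triquadratic.Γ) Φ → weilSpace {Φ, Elt.conj Octic.Triquadratic.Γ • Φ} ≤ Alg {Φ, Elt.conj Octic.Triquadratic.Γ • Φ})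
    (hreps : ∀ r ∈ Octic.Triquadratic.reps, weilSpace (cornersMul Octic.Triquadratic.Γ r) ≤ Alg (cornersMul Octic.Triquadratic.Γ r))
    (M : Multiset (Finset (Elt Octic.Triquadratic.Γ))) (hM : IsZeroSumG (Elt.conj Octic.Triquadratic.Γ) M) : weilSpace M ≤ Alg M :=
  Census.alg_of_reps_octicTriquadratic (fun N => weilSpace N ≤ Alg N)
    (fun M N _ _ => (gsetModelKP Alg Q hmul hproj hQ).alg_add M N)
    (fun M N _ _ => (gsetModelKP Alg Q hmul hproj hQ).alg_cancel M N) hpair (htwist_of_alg Alg halg) hreps M hM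

/-- **Row `Octic.Dihedral`** (degree 8, dihedral; 5) on the concrete model: S4 on the concrete Weil spaces of the sealed representatives'
corner products ⟹ S4 for every corner product of this Galois CM type. -/
theorem weilSpace_le_alg_of_reps_octicDihedral
    (Alg : ∀ M : Multiset (Finset (Elt Octic.Dihedral.Γ)), Submodule ℂ (H M))
    (Q : ∀ M : Multiset (Finset (Elt Octic.Dihedral.Γ)), LinearMap.BilinForm ℂ (H M))
    (hmul : ∀ M N, (Submodule.map₂ (TensorProduct.mk ℂ (H M) (H N)) (Alg M) (Alg N)).map (μ M N) ≤ Alg (M + N))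
    (hproj : ∀ M N (y : H N), y ∈ Alg N →
      ((Alg (M + N)).map (κ M N)).map (LemmaP.contract ((Q N).flip y)) ≤ Alg M)
    (hQ : ∀ N, N ≠ 0 → ∀ σ, ∃ τ, Q N (line (Multiset.card N) σ) (line (Multiset.card N) τ) ≠ 0)
    (halg : ∀ M g, (Alg M).map (twistEquiv M g : H M →ₗ[ℂ] H (twistMul M g)) ≤ Alg (twistMul M g))
    (hpair : ∀ Φ, IsCMType (Elt.conj Octic.Dihedral.Γ) Φ → weilSpace {Φ, Elt.conj Octic.Dihedral.Γ • Φ} ≤ Alg {Φ, Elt.conj Octic.Dihedral.Γ • Φ})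
    (hreps : ∀ r ∈ Octic.Dihedral.reps, weilSpace (cornersMul Octic.Dihedral.Γ r) ≤ Alg (cornersMul Octic.Dihedral.Γ r))
    (M : Multiset (Finset (Elt Octic.Dihedral.Γ))) (hM : IsZeroSumG (Elt.conj Octic.Dihedral.Γ) M) : weilSpace M ≤ Alg M :=
  Census.alg_of_reps_octicDihedral (fun N => weilSpace N ≤ Alg N)
    (fun M N _ _ => (gsetModelKP Alg Q hmul hproj hQ).alg_add M N)
    (fun M N _ _ => (gsetModelKP Alg Q hmul hproj hQ).alg_cancel M N) hpair (htwist_of_alg Alg halg) hreps M hM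

/-- **Row `Octic.Quaternion`** (degree 8, quaternion; 3) on the concrete model: S4 on the concrete Weil spaces of the sealed representatives'
corner products ⟹ S4 for every corner product of this Galois CM type. -/
theorem weilSpace_le_alg_of_reps_octicQuaternion
    (Alg : ∀ M : Multiset (Finset (Elt Octic.Quaternion.Γ)), Submodule ℂ (H M))
    (Q : ∀ M : Multiset (Finset (Elt Octic.Quaternion.Γ)), LinearMap.BilinForm ℂ (H M))
    (hmul : ∀ M N, (Submodule.map₂ (TensorProduct.mk ℂ (H M) (H N)) (Alg M) (Alg N)).map (μ M N) ≤ Alg (M + N))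
    (hproj : ∀ M N (y : H N), y ∈ Alg N →
      ((Alg (M + N)).map (κ M N)).map (LemmaP.contract ((Q N).flip y)) ≤ Alg M)
    (hQ : ∀ N, N ≠ 0 → ∀ σ, ∃ τ, Q N (line (Multiset.card N) σ) (line (Multiset.card N) τ) ≠ 0)
    (halg : ∀ M g, (Alg M).map (twistEquiv M g : H M →ₗ[ℂ] H (twistMul M g)) ≤ Alg (twistMul M g))
    (hpair : ∀ Φ, IsCMType (Elt.conj Octic.Quaternion.Γ) Φ → weilSpace {Φ, Elt.conj Octic.Quaternion.Γ • Φ} ≤ Alg {Φ, Elt.conj Octic.Quaternion.Γ • Φ})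
    (hreps : ∀ r ∈ Octic.Quaternion.reps, weilSpace (cornersMul Octic.Quaternion.Γ r) ≤ Alg (cornersMul Octic.Quaternion.Γ r))
    (M : Multiset (Finset (Elt Octic.Quaternion.Γ))) (hM : IsZeroSumG (Elt.conj Octic.Quaternion.Γ) M) : weilSpace M ≤ Alg M :=
  Census.alg_of_reps_octicQuaternion (fun N => weilSpace N ≤ Alg N)
    (fun M N _ _ => (gsetModelKP Alg Q hmul hproj hQ).alg_add M N)
    (fun M N _ _ => (gsetModelKP Alg Q hmul hproj hQ).alg_cancel M N) hpair (htwist_of_alg Alg halg) hreps M hM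

/-- **Row `Duodecic.Cyclic`** (degree 12, cyclic; 20) on the concrete model: S4 on the concrete Weil spaces of the sealed representatives'
corner products ⟹ S4 for every corner product of this Galois CM type. -/
theorem weilSpace_le_alg_of_reps_duodecicCyclic
    (Alg : ∀ M : Multiset (Finset (Elt Duodecic.Cyclic.Γ)), Submodule ℂ (H M))
    (Q : ∀ M : Multiset (Finset (Elt Duodecic.Cyclic.Γ)), LinearMap.BilinForm ℂ (H M))
    (hmul : ∀ M N, (Submodule.map₂ (TensorProduct.mk ℂ (H M) (H N)) (Alg M) (Alg N)).map (μ M N) ≤ Alg (M + N))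
    (hproj : ∀ M N (y : H N), y ∈ Alg N →
      ((Alg (M + N)).map (κ M N)).map (LemmaP.contract ((Q N).flip y)) ≤ Alg M)
    (hQ : ∀ N, N ≠ 0 → ∀ σ, ∃ τ, Q N (line (Multiset.card N) σ) (line (Multiset.card N) τ) ≠ 0)
    (halg : ∀ M g, (Alg M).map (twistEquiv M g : H M →ₗ[ℂ] H (twistMul M g)) ≤ Alg (twistMul M g))
    (hpair : ∀ Φ, IsCMType (Elt.conj Duodecic.Cyclic.Γ) Φ → weilSpace {Φ, Elt.conj Duodecic.Cyclic.Γ • Φ} ≤ Alg {Φ, Elt.conj Duodecic.Cyclic.Γ • Φ})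
    (hreps : ∀ r ∈ Duodecic.Cyclic.reps, weilSpace (cornersMul Duodecic.Cyclic.Γ r) ≤ Alg (cornersMul Duodecic.Cyclic.Γ r))
    (M : Multiset (Finset (Elt Duodecic.Cyclic.Γ))) (hM : IsZeroSumG (Elt.conj Duodecic.Cyclic.Γ) M) : weilSpace M ≤ Alg M :=
  Census.alg_of_reps_duodecicCyclic (fun N => weilSpace N ≤ Alg N)
    (fun M N _ _ => (gsetModelKP Alg Q hmul hproj hQ).alg_add M N)
    (fun M N _ _ => (gsetModelKP Alg Q hmul hproj hQ).alg_cancel M N) hpair (htwist_of_alg Alg halg) hreps M hM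

/-- **Row `Duodecic.C6C2`** (degree 12, C6 × C2; 22) on the concrete model: S4 on the concrete Weil spaces of the sealed representatives'
corner products ⟹ S4 for every corner product of this Galois CM type. -/
theorem weilSpace_le_alg_of_reps_duodecicC6C2
    (Alg : ∀ M : Multiset (Finset (Elt Duodecic.C6C2.Γ)), Submodule ℂ (H M))
    (Q : ∀ M : Multiset (Finset (Elt Duodecic.C6C2.Γ)), LinearMap.BilinForm ℂ (H M))
    (hmul : ∀ M N, (Submodule.map₂ (TensorProduct.mk ℂ (H M) (H N)) (Alg M) (Alg N)).map (μ M N) ≤ Alg (M + N))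
    (hproj : ∀ M N (y : H N), y ∈ Alg N →
      ((Alg (M + N)).map (κ M N)).map (LemmaP.contract ((Q N).flip y)) ≤ Alg M)
    (hQ : ∀ N, N ≠ 0 → ∀ σ, ∃ τ, Q N (line (Multiset.card N) σ) (line (Multiset.card N) τ) ≠ 0)
    (halg : ∀ M g, (Alg M).map (twistEquiv M g : H M →ₗ[ℂ] H (twistMul M g)) ≤ Alg (twistMul M g))
    (hpair : ∀ Φ, IsCMType (Elt.conj Duodecic.C6C2.Γ) Φ → weilSpace {Φ, Elt.conj Duodecic.C6C2.Γ • Φ} ≤ Alg {Φ, Elt.conj Duodecic.C6C2.Γ • Φ})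
    (hreps : ∀ r ∈ Duodecic.C6C2.reps, weilSpace (cornersMul Duodecic.C6C2.Γ r) ≤ Alg (cornersMul Duodecic.C6C2.Γ r))
    (M : Multiset (Finset (Elt Duodecic.C6C2.Γ))) (hM : IsZeroSumG (Elt.conj Duodecic.C6C2.Γ) M) : weilSpace M ≤ Alg M :=
  Census.alg_of_reps_duodecicC6C2 (fun N => weilSpace N ≤ Alg N)
    (fun M N _ _ => (gsetModelKP Alg Q hmul hproj hQ).alg_add M N)
    (fun M N _ _ => (gsetModelKP Alg Q hmul hproj hQ).alg_cancel M N) hpair (htwist_of_alg Alg halg) hreps M hM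

/-- **Row `Duodecic.Dihedral`** (degree 12, dihedral; 26) on the concrete model: S4 on the concrete Weil spaces of the sealed representatives'
corner products ⟹ S4 for every corner product of this Galois CM type. -/
theorem weilSpace_le_alg_of_reps_duodecicDihedral
    (Alg : ∀ M : Multiset (Finset (Elt Duodecic.Dihedral.Γ)), Submodule ℂ (H M))
    (Q : ∀ M : Multiset (Finset (Elt Duodecic.Dihedral.Γ)), LinearMap.BilinForm ℂ (H M))
    (hmul : ∀ M N, (Submodule.map₂ (TensorProduct.mk ℂ (H M) (H N)) (Alg M) (Alg N)).map (μ M N) ≤ Alg (M + N))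
    (hproj : ∀ M N (y : H N), y ∈ Alg N →
      ((Alg (M + N)).map (κ M N)).map (LemmaP.contract ((Q N).flip y)) ≤ Alg M)
    (hQ : ∀ N, N ≠ 0 → ∀ σ, ∃ τ, Q N (line (Multiset.card N) σ) (line (Multiset.card N) τ) ≠ 0)
    (halg : ∀ M g, (Alg M).map (twistEquiv M g : H M →ₗ[ℂ] H (twistMul M g)) ≤ Alg (twistMul M g))
    (hpair : ∀ Φ, IsCMType (Elt.conj Duodecic.Dihedral.Γ) Φ → weilSpace {Φ, Elt.conj Duodecic.Dihedral.Γ • Φ} ≤ Alg {Φ, Elt.conj Duodecic.Dihedral.Γ • Φ})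
    (hreps : ∀ r ∈ Duodecic.Dihedral.reps, weilSpace (cornersMul Duodecic.Dihedral.Γ r) ≤ Alg (cornersMul Duodecic.Dihedral.Γ r))
    (M : Multiset (Finset (Elt Duodecic.Dihedral.Γ))) (hM : IsZeroSumG (Elt.conj Duodecic.Dihedral.Γ) M) : weilSpace M ≤ Alg M :=
  Census.alg_of_reps_duodecicDihedral (fun N => weilSpace N ≤ Alg N)
    (fun M N _ _ => (gsetModelKP Alg Q hmul hproj hQ).alg_add M N)
    (fun M N _ _ => (gsetModelKP Alg Q hmul hproj hQ).alg_cancel M N) hpair (htwist_of_alg Alg halg) hreps M hM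

/-- **Row `Duodecic.Dicyclic`** (degree 12, dicyclic; 20) on the concrete model: S4 on the concrete Weil spaces of the sealed representatives'
corner products ⟹ S4 for every corner product of this Galois CM type. -/
theorem weilSpace_le_alg_of_reps_duodecicDicyclic
    (Alg : ∀ M : Multiset (Finset (Elt Duodecic.Dicyclic.Γ)), Submodule ℂ (H M))
    (Q : ∀ M : Multiset (Finset (Elt Duodecic.Dicyclic.Γ)), LinearMap.BilinForm ℂ (H M))
    (hmul : ∀ M N, (Submodule.map₂ (TensorProduct.mk ℂ (H M) (H N)) (Alg M) (Alg N)).map (μ M N) ≤ Alg (M + N))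
    (hproj : ∀ M N (y : H N), y ∈ Alg N →
      ((Alg (M + N)).map (κ M N)).map (LemmaP.contract ((Q N).flip y)) ≤ Alg M)
    (hQ : ∀ N, N ≠ 0 → ∀ σ, ∃ τ, Q N (line (Multiset.card N) σ) (line (Multiset.card N) τ) ≠ 0)
    (halg : ∀ M g, (Alg M).map (twistEquiv M g : H M →ₗ[ℂ] H (twistMul M g)) ≤ Alg (twistMul M g))
    (hpair : ∀ Φ, IsCMType (Elt.conj Duodecic.Dicyclic.Γ) Φ → weilSpace {Φ, Elt.conj Duodecic.Dicyclic.Γ • Φ} ≤ Alg {Φ, Elt.conj Duodecic.Dicyclic.Γ • Φ})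
    (hreps : ∀ r ∈ Duodecic.Dicyclic.reps, weilSpace (cornersMul Duodecic.Dicyclic.Γ r) ≤ Alg (cornersMul Duodecic.Dicyclic.Γ r))
    (M : Multiset (Finset (Elt Duodecic.Dicyclic.Γ))) (hM : IsZeroSumG (Elt.conj Duodecic.Dicyclic.Γ) M) : weilSpace M ≤ Alg M :=
  Census.alg_of_reps_duodecicDicyclic (fun N => weilSpace N ≤ Alg N)
    (fun M N _ _ => (gsetModelKP Alg Q hmul hproj hQ).alg_add M N)
    (fun M N _ _ => (gsetModelKP Alg Q hmul hproj hQ).alg_cancel M N) hpair (htwist_of_alg Alg halg) hreps M hM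

/-- **Degree 6 with its ONE face** on the concrete model: S4 on the concrete Weil space of the single sealed face's corner
product (`(7, 9, 18)`) ⟹ S4 for every corner product of the cyclic sextic type (gen 3's `Census.alg_of_sexticFace`). -/
theorem weilSpace_le_alg_of_sexticFace
    (Alg : ∀ M : Multiset (Finset (Elt Sextic.Cyclic.Γ)), Submodule ℂ (H M))
    (Q : ∀ M : Multiset (Finset (Elt Sextic.Cyclic.Γ)), LinearMap.BilinForm ℂ (H M))
    (hmul : ∀ M N, (Submodule.map₂ (TensorProduct.mk ℂ (H M) (H N)) (Alg M) (Alg N)).map (μ M N) ≤ Alg (M + N))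
    (hproj : ∀ M N (y : H N), y ∈ Alg N →
      ((Alg (M + N)).map (κ M N)).map (LemmaP.contract ((Q N).flip y)) ≤ Alg M)
    (hQ : ∀ N, N ≠ 0 → ∀ σ, ∃ τ, Q N (line (Multiset.card N) σ) (line (Multiset.card N) τ) ≠ 0)
    (halg : ∀ M g, (Alg M).map (twistEquiv M g : H M →ₗ[ℂ] H (twistMul M g)) ≤ Alg (twistMul M g))
    (hpair : ∀ Φ, IsCMType (Elt.conj Sextic.Cyclic.Γ) Φ → weilSpace {Φ, Elt.conj Sextic.Cyclic.Γ • Φ} ≤ Alg {Φ, Elt.conj Sextic.Cyclic.Γ • Φ})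
    (hface : weilSpace (cornersMul Sextic.Cyclic.Γ (7, 9, 18)) ≤ Alg (cornersMul Sextic.Cyclic.Γ (7, 9, 18)))
    (M : Multiset (Finset (Elt Sextic.Cyclic.Γ))) (hM : IsZeroSumG (Elt.conj Sextic.Cyclic.Γ) M) :
    weilSpace M ≤ Alg M :=
  Census.alg_of_sexticFace (fun N => weilSpace N ≤ Alg N)
    (fun M N _ _ => (gsetModelKP Alg Q hmul hproj hQ).alg_add M N)
    (fun M N _ _ => (gsetModelKP Alg Q hmul hproj hQ).alg_cancel M N) hpair (htwist_of_alg Alg halg) hface M hM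

end HodgeRepro.Night3.GSetModel
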